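import Summits.HodgeConjecture.HodgeConjecture.Theorems.CYFormCasimirCYFormSquarePrincipleCasimir
import Summits.HodgeConjecture.HodgeConjecture.Theses.CYFormCasimir
import Literature.AlgebraicGeometry.HodgeTheory.HyperbolicWeilTypeBalanced
import HarnessLib

/-!
# Crux X3 `CYFormSquarePrinciple` of route `CYFormCasimir` (stmt-HodgeConjecture-23494) — PROVED

research route conditional on HC_CM; not a corollary. This file proves the route decl X3
(`Summit.HodgeConjecture.HodgeConjecture.Theses.CYFormCasimir.CYFormSquarePrinciple`) and nothing
else: HC, HC_CM, the rung H2 and the cruxes X1/X2 of the route are NOT proved here.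

**Statement (Casimir principle, weight 4).** For `d > 0` and a Hodge-general (`HasHodgeGroupSU`) hyperbolic
`ℚ(√-d)`-Weil eightfold `(A, φ)` with a CY form `T ⊂ H⁴(A(ℂ); ℂ)` (`T ≤ ⋀⁴W ⊕ ⋀⁴W^*`, `T ∩ ⋀⁴W = 0`,
`dim T = 70`, spanned by rational and by pure-type classes): if `span{u ∪ v | u, v ∈ T} ⊂ H⁸` contains ONE
non-zero rational algebraic `(4,4)`-class `κ`, then every rational `(4,4)` Weil class of `(A, φ)` is
algebraic (`WeilAlgebraicFor 4 d A φ`).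

**Proof.** `κ` is a Hodge class, so `κ = r h_K⁴ + b T₊ + c T₋` (tree: van Geemen 6.12,
`exists_repr_of_mem_hodgeClassSpan_mid`; Weil classes are `(4,4)` in the hyperbolic case). By (A1) (helper
file `…HgStable`: `T` is `SU_H`-stable) and (A2) (helper file `…Casimir`: the Casimir principle, proved by
the torus/transposition uniqueness of invariant bilinear forms on `⋀⁴W^*`, helper file `…InvariantForms`)
`(b, c) ≠ (0, 0)` since `κ ≠ 0`. Hence `w = κ - r h_K⁴ = b T₊ + c T₋` is a non-zero ALGEBRAIC class of
the Weil plane (`h_K⁴` is a divisor monomial, algebraic by Lefschetz `(1,1)`); a test pull-back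
`(x·𝟙 + φ)^*` separates `T₊` from `T₋`, so one Weil eigen-line contains a non-zero algebraic class, and the
whole plane is algebraic (one-class lemma: eigen-lines + complex conjugation, the tree's
`weilClasses{Plus,Minus}_le_span_singleton`, `exists_mem_weilClasses{Plus,Minus}_mem_algebraicClasses`).

References: vanGeemenRapagnetta2026WeilHK (§1.11–1.15), vanGeemen1994HodgeAV (4.9, Lemma 5.2, Thm. 6.12),
MoonenZarhin1998WeilClasses (§1), Markman2025SurveySecant (§4), Deligne1982HodgeCycles (I §3, §4).
-/

-- `Summit.HodgeConjecture.HodgeConjecture.…` is the tree's mandated summit/problem namespace (single-problem summit).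
set_option linter.dupNamespace false
noncomputable section

open CategoryTheory
open Literature.AlgebraicTopology.SingularHomology
open Literature.AlgebraicGeometry.Motives
open Literature.AlgebraicGeometry.HodgeTheory
open Literature.AlgebraicGeometry.VanGeemen1994

namespace Summit.HodgeConjecture.HodgeConjecture.Theorems.CYFormSquare

section OneClass

variable {A : AbelianVariety ℂ} {d : ℕ} {φ : A ⟶ A}
variable (hn : 2 ≤ 4) (hd : 0 < d) (hA : A.dim = 2 * 4) (hφ : φ ≫ φ = -(d • 𝟙 A))
  (e : ProjectiveEmbedding A.X) {a : complexBetti (projectiveSpace e.n ℂ) 2} (ha : IsRationalClass a)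
  (ha0 : a ≠ 0)

include hd hA hφ in
/-- **One non-zero algebraic class in `⋀⁸W` makes the whole Weil plane algebraic** (the eigen-lines are
lines, and complex conjugation carries `⋀⁸W` to `⋀⁸W^*` preserving algebraicity). [cite: vanGeemen1994HodgeAV, proof of Lemma 5.2 (6) and 4.9] -/
theorem weilClassesOf_le_algebraicClasses_of_plus
    (h : ∃ c ∈ weilClassesPlus A φ 4 d, c ∈ algebraicClasses A.X 4 ∧ c ≠ 0) :
    weilClassesOf A φ 4 d ≤ algebraicClasses A.X 4 := by
  have hb₁ : Module.finrank ℂ (complexBetti A.X 1) = 2 * (2 * 4) := by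
    rw [abelianVarietyCohomologyExteriorH1_holds.finrank_one A, hA]
  obtain ⟨c₂, h₂, ha₂, h0₂⟩ := exists_mem_weilClassesMinus_mem_algebraicClasses h
  obtain ⟨c₁, h₁, ha₁, h0₁⟩ := h
  refine sup_le ?_ ?_
  · exact (weilClassesPlus_le_span_singleton (hasExteriorCohomologyH1 A) hb₁ hd hφ h₁ h0₁).trans
      ((Submodule.span_singleton_le_iff_mem _ _).2 ha₁)
  · exact (weilClassesMinus_le_span_singleton (hasExteriorCohomologyH1 A) hb₁ hd hφ h₂ h0₂).trans
      ((Submodule.span_singleton_le_iff_mem _ _).2 ha₂)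

include hd hA hφ in
/-- The same from one non-zero algebraic class in `⋀⁸W^*`. [cite: vanGeemen1994HodgeAV, proof of Lemma 5.2 (6) and 4.9] -/
theorem weilClassesOf_le_algebraicClasses_of_minus
    (h : ∃ c ∈ weilClassesMinus A φ 4 d, c ∈ algebraicClasses A.X 4 ∧ c ≠ 0) :
    weilClassesOf A φ 4 d ≤ algebraicClasses A.X 4 :=
  weilClassesOf_le_algebraicClasses_of_plus hd hA hφ (exists_mem_weilClassesPlus_mem_algebraicClasses h)

include hn hd hA hφ e ha ha0 in
/-- **An algebraic combination `b T₊ + c T₋ ≠ 0` makes the Weil plane algebraic**: a test pull-back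
`(x·𝟙 + φ)^*` with `(x + i√d)⁸ ≠ (x - i√d)⁸` (which exists, `eq_zero_of_forall_natCast_add_pow_eq`) separates the
two eigen-components, and pull-backs along endomorphisms preserve algebraic classes.
[cite: vanGeemen1994HodgeAV, 4.9 and proof of Thm. 6.12] [cite: MoonenZarhin1998WeilClasses, §1] -/
theorem weilClassesOf_le_algebraicClasses_of_combination {b c : ℂ} (hbc : ¬(b = 0 ∧ c = 0))
    (halg : b • TP hn hd hA hφ e ha ha0 + c • TM hn hd hA hφ e ha ha0 ∈ algebraicClasses A.X 4) :
    weilClassesOf A φ 4 d ≤ algebraicClasses A.X 4 := by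
  have hX : IsSmoothProjective A.dim A.X := AbelianVariety.isSmoothProjective_holds
  have hTP := TP_mem_weilClassesPlus hn hd hA hφ e ha ha0
  have hTM := TM_mem_weilClassesMinus hn hd hA hφ e ha ha0
  have hTP0 : TP hn hd hA hφ e ha ha0 ≠ 0 := Module.Basis.ne_zero _ _
  have hTM0 : TM hn hd hA hφ e ha ha0 ≠ 0 := Module.Basis.ne_zero _ _
  -- a separating test endomorphism `x₀·𝟙 + φ`
  obtain ⟨x₀, hx₀⟩ : ∃ x₀ : ℕ, ((x₀ : ℂ) + ((1 : ℕ) : ℂ) * Complex.I * (Real.sqrt d : ℂ)) ^ (2 * 4) ≠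
      ((x₀ : ℂ) - ((1 : ℕ) : ℂ) * Complex.I * (Real.sqrt d : ℂ)) ^ (2 * 4) := by
    by_contra hne
    simp only [not_exists, not_not, Nat.cast_one, one_mul] at hne
    exact mul_ne_zero Complex.I_ne_zero (sqrt_ne_zero_of_pos hd)
      (eq_zero_of_forall_natCast_add_pow_eq (m := 2 * 4) (by norm_num) hne)
  set χp : ℂ := ((x₀ : ℂ) + ((1 : ℕ) : ℂ) * Complex.I * (Real.sqrt d : ℂ)) ^ (2 * 4) with hχp
  set χm : ℂ := ((x₀ : ℂ) - ((1 : ℕ) : ℂ) * Complex.I * (Real.sqrt d : ℂ)) ^ (2 * 4) with hχm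
  have hΨP : complexBetti.map (x₀ • 𝟙 A + (1 : ℕ) • φ).hom.hom.hom (2 * 4) (TP hn hd hA hφ e ha ha0) =
      χp • TP hn hd hA hφ e ha ha0 := (mem_weilClassesPlus_iff.1 hTP) x₀ 1
  have hΨM : complexBetti.map (x₀ • 𝟙 A + (1 : ℕ) • φ).hom.hom.hom (2 * 4) (TM hn hd hA hφ e ha ha0) =
      χm • TM hn hd hA hφ e ha ha0 := (mem_weilClassesMinus_iff.1 hTM) x₀ 1
  have halg' : complexBetti.map (x₀ • 𝟙 A + (1 : ℕ) • φ).hom.hom.hom (2 * 4)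
      (b • TP hn hd hA hφ e ha ha0 + c • TM hn hd hA hφ e ha ha0) ∈ algebraicClasses A.X 4 :=
    map_mem_algebraicClasses_of_abelianVariety hX A _ halg
  rw [map_add, map_smul, map_smul, hΨP, hΨM] at halg'
  by_cases hb : b = 0
  · -- `c ≠ 0`: `w = c T₋`
    have hc : c ≠ 0 := fun hc ↦ hbc ⟨hb, hc⟩
    rw [hb, zero_smul, zero_add] at halg
    refine weilClassesOf_le_algebraicClasses_of_minus hd hA hφ ⟨_, hTM, ?_, hTM0⟩
    have h := Submodule.smul_mem _ c⁻¹ halg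
    rwa [smul_smul, inv_mul_cancel₀ hc, one_smul] at h
  · -- `b ≠ 0`: `(x₀·𝟙 + φ)^* w - χ₋ w = b (χ₊ - χ₋) T₊`
    have h1 : (b * (χp - χm)) • TP hn hd hA hφ e ha ha0 ∈ algebraicClasses A.X 4 := by
      have h := Submodule.sub_mem _ halg' (Submodule.smul_mem _ χm halg)
      have e1 : b • χp • TP hn hd hA hφ e ha ha0 + c • χm • TM hn hd hA hφ e ha ha0 -
          χm • (b • TP hn hd hA hφ e ha ha0 + c • TM hn hd hA hφ e ha ha0) = (b * (χp - χm)) • TP hn hd hA hφ e ha ha0 := by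
        module
      rwa [e1] at h
    refine weilClassesOf_le_algebraicClasses_of_plus hd hA hφ ⟨_, hTP, ?_, hTP0⟩
    have hne : b * (χp - χm) ≠ 0 := mul_ne_zero hb (sub_ne_zero.2 hx₀)
    have h := Submodule.smul_mem _ (b * (χp - χm))⁻¹ h1
    rwa [smul_smul, inv_mul_cancel₀ hne, one_smul] at h

end OneClass

end Summit.HodgeConjecture.HodgeConjecture.Theorems.CYFormSquare

namespace Summit.HodgeConjecture.HodgeConjecture.Theorems

open Summit.HodgeConjecture.HodgeConjecture.Theorems.CYFormSquare

/-- **Crux X3 `CYFormSquarePrinciple` of route `CYFormCasimir` (stmt-HodgeConjecture-23494).** For `d > 0`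
and a Hodge-general hyperbolic `ℚ(√-d)`-Weil eightfold `(A, φ)` with a CY form `T ⊂ H⁴(A(ℂ); ℂ)`, one
non-zero rational algebraic `(4,4)`-class in `span(T·T)` makes every rational `(4,4)` Weil class of
`(A, φ)` algebraic. research route conditional on HC_CM; not a corollary; HC / HC_CM / H2 are not proved.
[cite: vanGeemenRapagnetta2026WeilHK, §1.11–1.15] [cite: vanGeemen1994HodgeAV, Thm. 6.12] [cite: MoonenZarhin1998WeilClasses, §1] -/
theorem CYFormSquarePrinciple_proof : Summit.HodgeConjecture.HodgeConjecture.Theses.CYFormCasimir.CYFormSquarePrinciple := by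
  intro d hd A φ e a hA hφ ha ha0 hhyp hSU T hTle hT0 hT70 hTrat hThs hκex
  obtain ⟨κ, hκ, hκ0, hκrat, hκtyp, hκalg⟩ := hκex
  have hn : 2 ≤ 4 := by norm_num
  -- the Weil classes of the hyperbolic eightfold are of type `(4,4)`
  have hW : ∀ c ∈ weilClassesOf A φ 4 d, IsOfHodgeType (2 * 4) A.X (2 * 4) 4 4 c := fun c hc ↦
    isOfHodgeType_of_mem_weilClassesOf_of_isHyperbolicWeilType (by norm_num) hd hA hφ e ha ha0 hhyp hc
  -- `κ = r h_K⁴ + b T₊ + c T₋`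
  have hκB : κ ∈ hodgeClassSpan A.dim A.X 4 := Submodule.subset_span ⟨hκrat, by rw [hA]; exact hκtyp⟩
  obtain ⟨r, b, c, hrepr⟩ := exists_repr_of_mem_hodgeClassSpan_mid hn hd hA hφ e ha ha0 hW hSU hκB
  -- the hypotheses on `T` in the tree's spelling of `⋀⁴W`, `⋀⁴W^*`
  have hTle' : T ≤ weilClassesPlus A φ 2 d ⊔ weilClassesMinus A φ 2 d := hTle
  have hT0' : T ⊓ weilClassesPlus A φ 2 d = ⊥ := hT0
  -- (A1) + (A2): the Weil component of `κ` is non-zero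
  have hbc : ¬(b = 0 ∧ c = 0) := by
    rintro ⟨hb, hc⟩
    refine hκ0 (eq_zero_of_mem_span_cup_of_eq_smul_hK hn hd hA hφ e ha ha0 hSU hTle' hT0' hT70 hTrat hThs hW hκ
      (r := r) ?_)
    rw [hrepr, hb, hc, zero_smul, zero_smul, add_zero, add_zero]
  -- `w = κ - r h_K⁴ = b T₊ + c T₋` is algebraic
  have h11 : ∀ b' : complexBetti A.X (2 * 1), IsRationalClass b' → IsOfHodgeType A.dim A.X (2 * 1) 1 1 b' →
      b' ∈ algebraicClasses A.X 1 :=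
    fun b' hb hb' ↦ lefschetzOneOne_rational_holds (AbelianVariety.isSmoothProjective_holds (A := A)) b' hb hb'
  have hh4 : cupPowTwo (hK d φ e a) 4 ∈ algebraicClasses A.X 4 :=
    AbelianVariety.divisorClassesSpan_le_algebraicClasses A h11 4
      (Submodule.subset_span (cupPowTwo_hK_mem_divisorMonomials hn hd hA e ha ha0 4))
  have halg : b • TP hn hd hA hφ e ha ha0 + c • TM hn hd hA hφ e ha ha0 ∈ algebraicClasses A.X 4 := by
    have h := Submodule.sub_mem _ hκalg (Submodule.smul_mem _ r hh4)
    have e1 : κ - r • cupPowTwo (hK d φ e a) 4 = b • TP hn hd hA hφ e ha ha0 + c • TM hn hd hA hφ e ha ha0 := by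
      rw [hrepr]; abel
    rwa [e1] at h
  -- one-class lemma
  have hle := weilClassesOf_le_algebraicClasses_of_combination hn hd hA hφ e ha ha0 hbc halg
  exact fun c' hc' _ _ ↦ hle hc'

end Summit.HodgeConjecture.HodgeConjecture.Theorems

end
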